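import Summits.BirchSwinnertonDyer.BirchSwinnertonDyer.Theorems.SignedLowerHalvesKobayashiMainConjectureSmallImageShadowInert
import Literature.NumberTheory.EllipticCurves.ModPCongruenceIsomorphismProofs
import Literature.NumberTheory.EllipticCurves.SupersingularDensitySerreTraceProofs
import HarnessLib

/-!
# The Frobenius dictionary of a non-split dihedral mod-`p` image (traces in and outside `U`)

Route `SignedLowerHalves`, child L `SmallImageLowerHalfBothSigns` (item stmt-BirchSwinnertonDyer-23599), line
proposal `rtt_w3`, stub K0₂@p `stub_heckeThetaPartner_ns` — brick AH7/AH8 ("frame dictionary") of the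
arithmetic half at an ODD prime (width seat `bsd-line-slh-p3-w3` gen 9; memo `Lines/birth_acns-MEMO-w3-g9.md`).
THEOREMS ONLY (no definition, no named fact, no `sorry`); ROUTE-INDEPENDENT.

Setting (the CM shadow of k3-c4's `smallImage_exists_frame_shadow_inert`): `E = W/ℚ` globally minimal, a
prime `p`, a frame `(e, Φ)` of `E[p]` with the trace clause, a field `k ⊆ M₂(𝔽_p)` of degree `2` whose unit
group `kˣ` (a non-split Cartan subgroup) is normalised by the image `Φ(ρ̄(Γ_ℚ))`, and
`U = ρ̄⁻¹(Φ⁻¹(kˣ))` (the absolute Galois group of the dihedral field `K`).  Serre 1972 §2.2: conjugation by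
an element of `N(kˣ) ∖ kˣ` is the non-trivial automorphism `y ↦ ȳ = tr(y)·1 − y` of `k`, and such elements
square to scalars.  We record the consequences that the CM-partner construction consumes:

* §1 (`GL₂(F)`): `sq_eq_trace_smul_sub_det_smul` (Cayley–Hamilton for `2 × 2`),
  `trace_eq_zero_of_mem_normalizer_of_not_mem` / `sq_eq_neg_det_smul_one_of_mem_normalizer_of_not_mem`
  (elements of `N(kˣ) ∖ kˣ` have trace `0` and square `−det · 1`), `conj_eq_trace_smul_one_sub`
  (for `n ∈ N(kˣ) ∖ kˣ` and EVERY `y ∈ k`: `n y n⁻¹ = ȳ`), `add_conj_eq_trace_smul_one`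
  (`y + n y n⁻¹ = tr(y)·1`).
* §2 (on `E[p]`): for `σ ∉ U` the trace of `ρ̄(σ)` on `E[p]` vanishes (`trace_eq_zero_of_not_mem`), so at a
  good prime `ℓ ≠ p` whose arithmetic Frobenius lies outside `U` ("`ℓ` inert in `K`") **`p ∣ a_ℓ(E)`**
  (`dvd_frobeniusTrace_of_frob_not_mem`) and `Φ(ρ̄(σ²)) = −ℓ·1` (`frob_sq_eq_neg_smul_one_of_not_mem`);
  for `σ ∈ U` and any `τ ∉ U`, `Φ(ρ̄ σ) + Φ(ρ̄(τστ⁻¹)) = tr·1`, which at a good `ℓ ≠ p` with Frobenius in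
  `U` ("`ℓ` split in `K`") reads **`Φ(ρ̄ Frob) + Φ(ρ̄(τ Frob τ⁻¹)) = a_ℓ(E)·1` in `k`**
  (`frob_add_conj_eq_frobeniusTrace_smul_one_of_mem`) — the two summands being `χ̄(Frob_w)`, `χ̄(Frob_w̄)`
  of `ρ̄ ≅ Ind_K χ̄`; and `det Φ(ρ̄ Frob_ℓ) = ℓ` (`det_frob_eq`).

These are the identities behind "`a_ℓ(θ_ψ) = ψ(w) + ψ(w̄) ≡ a_ℓ(E)` at split `ℓ`, `= 0 ≡ a_ℓ(E)` at inert
`ℓ`" and "`ψ̃((ℓ)) ≡ χ_K(ℓ)·ℓ`" (trivial Nebentypus) of the odd-`p` Hecke theta partner.  BSD, crux L and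
the stub are NOT proved here.

References: J.-P. Serre, Invent. Math. 15 (1972) §2.2 (Cartan subgroups and their normalisers), §4.2 c);
K. Ribet, LNM 601 (1977) §3.
-/

set_option autoImplicit false
set_option linter.dupNamespace false

noncomputable section

open scoped Classical NumberField MatrixGroups
open IsDedekindDomain Field Matrix NumberField WeierstrassCurve Literature.NumberTheory.EllipticCurves
  Literature.NumberTheory.GaloisRepresentations Rat.HeightOneSpectrum
  Literature.NumberTheory.EllipticCurves.Rank1Residual

namespace Summit.BirchSwinnertonDyer.BirchSwinnertonDyer.Theorems.SmallImageLambdaLowerThreeNsThetaPartner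

/-! ### §1. `GL₂(F)`: elements of `N(kˣ) ∖ kˣ` -/

section GL2

variable {F : Type*} [Field F]

/-- Cayley–Hamilton for `2 × 2` matrices: `g² = tr(g)·g − det(g)·1`. [folklore] -/
theorem sq_eq_trace_smul_sub_det_smul (g : Matrix (Fin 2) (Fin 2) F) :
    g * g = g.trace • g - g.det • (1 : Matrix (Fin 2) (Fin 2) F) := by
  ext i j
  fin_cases i <;> fin_cases j <;>
    simp [Matrix.mul_apply, Fin.sum_univ_two, Matrix.trace_fin_two, Matrix.det_fin_two] <;> ring

/-- For `n ∈ N(kˣ) ∖ kˣ` (`k ⊆ M₂(F)` a field of degree `2`) and EVERY `y ∈ k`: `n y n⁻¹ = ȳ = tr(y)·1 − y`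
(Serre 1972 §2.2: "l'application `x ↦ s x s⁻¹` est un automorphisme non trivial de `k`"; for scalar `y`
both sides are `y`). [cite: Serre1972, §2.2] -/
theorem conj_eq_trace_smul_one_sub {k : Subalgebra F (Matrix (Fin 2) (Fin 2) F)} (hk : IsField k)
    {y : Matrix (Fin 2) (Fin 2) F} (hy : y ∈ k) {n : GL (Fin 2) F}
    (hn : n ∈ Subgroup.normalizer (Serre1972.unitGroup k : Set (GL (Fin 2) F)))
    (hnC : n ∉ Serre1972.unitGroup k) :
    (n : Matrix (Fin 2) (Fin 2) F) * y * (n : Matrix (Fin 2) (Fin 2) F)⁻¹ = y.trace • 1 - y := by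
  by_cases hys : ∀ c : F, y ≠ c • 1
  · rcases Serre1972.conj_eq_or_conj_eq_of_mem_normalizer hk hy hys hn with h | h
    · exact absurd (Serre1972.mem_unitGroup_of_conj_eq hy hys h) hnC
    · exact h
  · push Not at hys
    obtain ⟨c, rfl⟩ := hys
    have hnu : IsUnit (n : Matrix (Fin 2) (Fin 2) F).det := (GL2.det_ne_zero n).isUnit
    rw [Matrix.mul_smul, Matrix.mul_one, Matrix.smul_mul, Matrix.mul_nonsing_inv _ hnu,
      Matrix.trace_smul, Matrix.trace_one, Fintype.card_fin]
    ext i j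
    fin_cases i <;> fin_cases j <;> simp <;> ring

/-- `y + n y n⁻¹ = tr(y)·1` for `n ∈ N(kˣ) ∖ kˣ` and `y ∈ k`. [cite: Serre1972, §2.2] -/
theorem add_conj_eq_trace_smul_one {k : Subalgebra F (Matrix (Fin 2) (Fin 2) F)} (hk : IsField k)
    {y : Matrix (Fin 2) (Fin 2) F} (hy : y ∈ k) {n : GL (Fin 2) F}
    (hn : n ∈ Subgroup.normalizer (Serre1972.unitGroup k : Set (GL (Fin 2) F)))
    (hnC : n ∉ Serre1972.unitGroup k) :
    y + (n : Matrix (Fin 2) (Fin 2) F) * y * (n : Matrix (Fin 2) (Fin 2) F)⁻¹ = y.trace • 1 := by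
  rw [conj_eq_trace_smul_one_sub hk hy hn hnC, add_sub_cancel]

variable {p : ℕ} [Fact p.Prime]

/-- **Elements of `N(kˣ) ∖ kˣ` have trace zero** (`k ⊆ M₂(𝔽_p)` a field of degree `2`): such an element
`n` squares to a scalar (Serre 1972 §2.2, tree `sq_eq_smul_one_of_mem_normalizer_unitGroup`), so by
Cayley–Hamilton `tr(n)·n` is a scalar, and `n` is not (scalars lie in `kˣ`). [cite: Serre1972, §2.2] -/
theorem trace_eq_zero_of_mem_normalizer_of_not_mem
    {k : Subalgebra (ZMod p) (Matrix (Fin 2) (Fin 2) (ZMod p))} (hk : IsField k)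
    (h2 : Module.finrank (ZMod p) k = 2) {n : GL (Fin 2) (ZMod p)}
    (hn : n ∈ Subgroup.normalizer (Serre1972.unitGroup k : Set (GL (Fin 2) (ZMod p))))
    (hnC : n ∉ Serre1972.unitGroup k) :
    (n : Matrix (Fin 2) (Fin 2) (ZMod p)).trace = 0 := by
  obtain ⟨y₀, hy₀, hys⟩ := Serre1972.exists_mem_forall_ne_smul_one h2
  obtain ⟨c, hc⟩ := Serre1972.sq_eq_smul_one_of_mem_normalizer_unitGroup hk hy₀ hys
    (Serre1972.trace_sq_sub_four_det_ne_zero_of_isField hk hy₀ hys) hn hnC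
  set N : Matrix (Fin 2) (Fin 2) (ZMod p) := (n : Matrix (Fin 2) (Fin 2) (ZMod p)) with hN
  have hsq : N * N = c • 1 := by rw [← hc, Units.val_pow_eq_pow_val, sq]
  have hCH := sq_eq_trace_smul_sub_det_smul N
  by_contra ht
  apply hnC
  rw [Serre1972.mem_unitGroup_iff]
  have hNs : N = N.trace⁻¹ • ((c + N.det) • (1 : Matrix (Fin 2) (Fin 2) (ZMod p))) := by
    have : N.trace • N = (c + N.det) • (1 : Matrix (Fin 2) (Fin 2) (ZMod p)) := by
      rw [add_smul, ← hsq, hCH, sub_add_cancel]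
    rw [← this, smul_smul, inv_mul_cancel₀ ht, one_smul]
  change N ∈ k
  rw [hNs, smul_smul]
  exact k.smul_mem k.one_mem _

/-- Hence `n² = −det(n)·1` for `n ∈ N(kˣ) ∖ kˣ`. [cite: Serre1972, §2.2] -/
theorem sq_eq_neg_det_smul_one_of_mem_normalizer_of_not_mem
    {k : Subalgebra (ZMod p) (Matrix (Fin 2) (Fin 2) (ZMod p))} (hk : IsField k)
    (h2 : Module.finrank (ZMod p) k = 2) {n : GL (Fin 2) (ZMod p)}
    (hn : n ∈ Subgroup.normalizer (Serre1972.unitGroup k : Set (GL (Fin 2) (ZMod p))))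
    (hnC : n ∉ Serre1972.unitGroup k) :
    (n : Matrix (Fin 2) (Fin 2) (ZMod p)) * (n : Matrix (Fin 2) (Fin 2) (ZMod p)) =
      -((n : Matrix (Fin 2) (Fin 2) (ZMod p)).det • (1 : Matrix (Fin 2) (Fin 2) (ZMod p))) := by
  rw [sq_eq_trace_smul_sub_det_smul, trace_eq_zero_of_mem_normalizer_of_not_mem hk h2 hn hnC, zero_smul,
    zero_sub]

end GL2

/-! ### §2. On `E[p]`: traces of Frobenius inside and outside `U` -/

section Curve

variable (W : WeierstrassCurve ℚ) [W.IsElliptic] [W.IsGloballyMinimal] (p : ℕ) [Fact p.Prime]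
  (Φ : Multiplicative (AddAut (geomTorsion W p)) ≃* GL (Fin 2) (ZMod p))
  {k : Subalgebra (ZMod p) (Matrix (Fin 2) (Fin 2) (ZMod p))}

omit [W.IsElliptic] [W.IsGloballyMinimal] in
/-- The image normalises `kˣ`: every `Φ(ρ̄ σ)` lies in `N(kˣ)`. [folklore] -/
theorem frob_mem_normalizer
    (hGN : (galoisRepTorsion W p).range.map Φ.toMonoidHom ≤
      Subgroup.normalizer (Serre1972.unitGroup k : Set (GL (Fin 2) (ZMod p))))
    (σ : absoluteGaloisGroup ℚ) :
    Φ (galoisRepTorsion W p σ) ∈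
      Subgroup.normalizer (Serre1972.unitGroup k : Set (GL (Fin 2) (ZMod p))) :=
  hGN ⟨galoisRepTorsion W p σ, ⟨σ, rfl⟩, rfl⟩

omit [W.IsElliptic] [W.IsGloballyMinimal] in
/-- **Outside `U` the trace vanishes**: for `σ ∉ U = ρ̄⁻¹(Φ⁻¹(kˣ))`, `tr Φ(ρ̄ σ) = 0`.
[cite: Serre1972, §2.2] -/
theorem trace_eq_zero_of_not_mem (hk : IsField k) (h2 : Module.finrank (ZMod p) k = 2)
    (hGN : (galoisRepTorsion W p).range.map Φ.toMonoidHom ≤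
      Subgroup.normalizer (Serre1972.unitGroup k : Set (GL (Fin 2) (ZMod p))))
    {σ : absoluteGaloisGroup ℚ}
    (hσ : σ ∉ ((Serre1972.unitGroup k).comap Φ.toMonoidHom).comap (galoisRepTorsion W p)) :
    ((Φ (galoisRepTorsion W p σ) : GL (Fin 2) (ZMod p)) : Matrix (Fin 2) (Fin 2) (ZMod p)).trace = 0 :=
  trace_eq_zero_of_mem_normalizer_of_not_mem hk h2 (frob_mem_normalizer W p Φ hGN σ) hσ

/-- **`p ∣ a_ℓ(E)` at a good prime `ℓ ≠ p` whose Frobenius lies outside `U`** ("`ℓ` inert in the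
dihedral field `K`": the inert primes are supersingular-type mod `p`).  Frame with the trace clause of
`exists_frame_galoisRepTorsion_rat`. [cite: Serre1972, §2.2 and §4.2 c)] -/
theorem dvd_frobeniusTrace_of_frob_not_mem (hk : IsField k) (h2 : Module.finrank (ZMod p) k = 2)
    (htr : letI : Module (ZMod p) (geomTorsion W p) := AddSubgroup.torsionBy.zmodModule
      ∀ g : Multiplicative (AddAut (geomTorsion W p)),
        Matrix.trace ((Φ g : GL (Fin 2) (ZMod p)) : Matrix (Fin 2) (Fin 2) (ZMod p)) =
          LinearMap.trace (ZMod p) (geomTorsion W p) ((Multiplicative.toAdd g).toAddMonoidHom.toZModLinearMap p))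
    (hGN : (galoisRepTorsion W p).range.map Φ.toMonoidHom ≤
      Subgroup.normalizer (Serre1972.unitGroup k : Set (GL (Fin 2) (ZMod p))))
    {ℓ : ℕ} [Fact ℓ.Prime] (hℓp : ℓ ≠ p) (hgood : W.HasGoodReductionAtPrime ℓ)
    {v : HeightOneSpectrum (𝓞 ℚ)} (hv : (primesEquiv v : ℕ) = ℓ)
    {𝔓 : Ideal (absIntegers (𝓞 ℚ) ℚ)} (h𝔓 : 𝔓 ∈ v.primesAbove)
    {σ : absoluteGaloisGroup ℚ} (hσF : IsArithFrobAt (𝓞 ℚ) σ 𝔓)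
    (hσ : σ ∉ ((Serre1972.unitGroup k).comap Φ.toMonoidHom).comap (galoisRepTorsion W p)) :
    (p : ℤ) ∣ W.frobeniusTrace ℓ := by
  letI : Module (ZMod p) (geomTorsion W p) := AddSubgroup.torsionBy.zmodModule
  have h0 := trace_eq_zero_of_not_mem W p Φ hk h2 hGN hσ
  rw [htr, W.trace_galoisRepTorsion_frobenius_eq p hℓp hgood hv h𝔓 hσF] at h0
  exact (ZMod.intCast_zmod_eq_zero_iff_dvd _ p).mp h0

omit [W.IsElliptic] [W.IsGloballyMinimal] in
/-- The determinant of `Φ(ρ̄ σ)` is the determinant of `ρ̄(σ)` on `E[p]` (transport through the frame).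
[folklore] -/
theorem det_coe_eq_det (e : geomTorsion W p ≃+ (Fin 2 → ZMod p))
    (he : ∀ (g : Multiplicative (AddAut (geomTorsion W p))) (x : geomTorsion W p),
      e (Multiplicative.toAdd g x) = ((Φ g : GL (Fin 2) (ZMod p)) : Matrix (Fin 2) (Fin 2) (ZMod p)) *ᵥ e x)
    (σ : absoluteGaloisGroup ℚ) :
    letI : Module (ZMod p) (geomTorsion W p) := AddSubgroup.torsionBy.zmodModule
    ((Φ (galoisRepTorsion W p σ) : GL (Fin 2) (ZMod p)) : Matrix (Fin 2) (Fin 2) (ZMod p)).det =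
      LinearMap.det ((galoisRepTorsion W p σ).toAdd.toAddMonoidHom.toZModLinearMap p) := by
  letI : Module (ZMod p) (geomTorsion W p) := AddSubgroup.torsionBy.zmodModule
  set x : GL (Fin 2) (ZMod p) := Φ (galoisRepTorsion W p σ) with hxdef
  have hσM : ∀ Q : W.geomTorsion p, e (σ • Q) = (x : Matrix (Fin 2) (Fin 2) (ZMod p)) *ᵥ e Q := fun Q ↦ by
    rw [← galoisRepTorsion_apply]; exact he _ Q
  let eL : W.geomTorsion p ≃ₗ[ZMod p] (Fin 2 → ZMod p) :=
    LinearEquiv.ofBijective (e.toAddMonoidHom.toZModLinearMap p) ⟨e.injective, e.surjective⟩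
  have heL : ∀ Q : W.geomTorsion p, eL Q = e Q := fun _ ↦ rfl
  have hconj : Matrix.toLin' (x : Matrix (Fin 2) (Fin 2) (ZMod p)) =
      eL.conj ((galoisRepTorsion W p σ).toAdd.toAddMonoidHom.toZModLinearMap p) := by
    refine LinearMap.ext fun u ↦ ?_
    obtain ⟨Q, rfl⟩ := eL.surjective u
    rw [LinearEquiv.conj_apply_apply, eL.symm_apply_apply, heL, heL, Matrix.toLin'_apply]
    change (x : Matrix (Fin 2) (Fin 2) (ZMod p)) *ᵥ (e Q) = e (σ • Q)
    rw [hσM]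
  rw [← LinearMap.det_toLin' (x : Matrix (Fin 2) (Fin 2) (ZMod p)), hconj, LinearEquiv.conj_apply,
    LinearMap.comp_assoc, LinearMap.det_conj]

omit [W.IsGloballyMinimal] in
/-- **`det Φ(ρ̄ Frob_ℓ) = ℓ`** at a good prime `ℓ ≠ p` (Weil pairing; tree `det_galoisRepTorsion_frobenius_eq`).
[cite: Serre1972, §4.2 c)] -/
theorem det_frob_eq (e : geomTorsion W p ≃+ (Fin 2 → ZMod p))
    (he : ∀ (g : Multiplicative (AddAut (geomTorsion W p))) (x : geomTorsion W p),
      e (Multiplicative.toAdd g x) = ((Φ g : GL (Fin 2) (ZMod p)) : Matrix (Fin 2) (Fin 2) (ZMod p)) *ᵥ e x)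
    {ℓ : ℕ} [Fact ℓ.Prime] (hℓp : ℓ ≠ p) (hgood : W.HasGoodReductionAtPrime ℓ)
    {v : HeightOneSpectrum (𝓞 ℚ)} (hv : (primesEquiv v : ℕ) = ℓ)
    {𝔓 : Ideal (absIntegers (𝓞 ℚ) ℚ)} (h𝔓 : 𝔓 ∈ v.primesAbove)
    {σ : absoluteGaloisGroup ℚ} (hσF : IsArithFrobAt (𝓞 ℚ) σ 𝔓) :
    ((Φ (galoisRepTorsion W p σ) : GL (Fin 2) (ZMod p)) : Matrix (Fin 2) (Fin 2) (ZMod p)).det = (ℓ : ZMod p) := by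
  rw [det_coe_eq_det W p Φ e he σ]
  exact W.det_galoisRepTorsion_frobenius_eq p hℓp hgood hv h𝔓 hσF

omit [W.IsGloballyMinimal] in
/-- **Outside `U` the square of Frobenius is the scalar `−ℓ`**: for a good `ℓ ≠ p` with arithmetic
Frobenius `σ ∉ U`, `Φ(ρ̄ σ)·Φ(ρ̄ σ) = −ℓ·1` — so `Φ(ρ̄(σ²)) ∈ kˣ` is the scalar `−ℓ = χ_K(ℓ)·ℓ`
(the value `χ̄(Frob_w)` at the inert prime `w = ℓ𝓞_K`, of Frobenius `σ²`). [cite: Serre1972, §2.2] -/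
theorem frob_sq_eq_neg_smul_one_of_not_mem (hk : IsField k) (h2 : Module.finrank (ZMod p) k = 2)
    (e : geomTorsion W p ≃+ (Fin 2 → ZMod p))
    (he : ∀ (g : Multiplicative (AddAut (geomTorsion W p))) (x : geomTorsion W p),
      e (Multiplicative.toAdd g x) = ((Φ g : GL (Fin 2) (ZMod p)) : Matrix (Fin 2) (Fin 2) (ZMod p)) *ᵥ e x)
    (hGN : (galoisRepTorsion W p).range.map Φ.toMonoidHom ≤
      Subgroup.normalizer (Serre1972.unitGroup k : Set (GL (Fin 2) (ZMod p))))
    {ℓ : ℕ} [Fact ℓ.Prime] (hℓp : ℓ ≠ p) (hgood : W.HasGoodReductionAtPrime ℓ)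
    {v : HeightOneSpectrum (𝓞 ℚ)} (hv : (primesEquiv v : ℕ) = ℓ)
    {𝔓 : Ideal (absIntegers (𝓞 ℚ) ℚ)} (h𝔓 : 𝔓 ∈ v.primesAbove)
    {σ : absoluteGaloisGroup ℚ} (hσF : IsArithFrobAt (𝓞 ℚ) σ 𝔓)
    (hσ : σ ∉ ((Serre1972.unitGroup k).comap Φ.toMonoidHom).comap (galoisRepTorsion W p)) :
    ((Φ (galoisRepTorsion W p (σ * σ)) : GL (Fin 2) (ZMod p)) : Matrix (Fin 2) (Fin 2) (ZMod p)) =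
      -((ℓ : ZMod p) • (1 : Matrix (Fin 2) (Fin 2) (ZMod p))) := by
  rw [map_mul, map_mul, Units.val_mul,
    sq_eq_neg_det_smul_one_of_mem_normalizer_of_not_mem hk h2 (frob_mem_normalizer W p Φ hGN σ) hσ,
    det_frob_eq W p Φ e he hℓp hgood hv h𝔓 hσF]

omit [W.IsElliptic] [W.IsGloballyMinimal] in
/-- **Inside `U`: `Φ(ρ̄ σ) + Φ(ρ̄(τστ⁻¹)) = tr(ρ̄ σ)·1`** for `σ ∈ U` and ANY `τ ∉ U` (conjugation by
`Φ(ρ̄ τ) ∈ N(kˣ) ∖ kˣ` is `y ↦ ȳ` on `k`). [cite: Serre1972, §2.2] -/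
theorem frob_add_conj_eq_trace_smul_one_of_mem (hk : IsField k)
    (hGN : (galoisRepTorsion W p).range.map Φ.toMonoidHom ≤
      Subgroup.normalizer (Serre1972.unitGroup k : Set (GL (Fin 2) (ZMod p))))
    {σ τ : absoluteGaloisGroup ℚ}
    (hσ : σ ∈ ((Serre1972.unitGroup k).comap Φ.toMonoidHom).comap (galoisRepTorsion W p))
    (hτ : τ ∉ ((Serre1972.unitGroup k).comap Φ.toMonoidHom).comap (galoisRepTorsion W p)) :
    ((Φ (galoisRepTorsion W p σ) : GL (Fin 2) (ZMod p)) : Matrix (Fin 2) (Fin 2) (ZMod p)) +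
        ((Φ (galoisRepTorsion W p (τ * σ * τ⁻¹)) : GL (Fin 2) (ZMod p)) : Matrix (Fin 2) (Fin 2) (ZMod p)) =
      ((Φ (galoisRepTorsion W p σ) : GL (Fin 2) (ZMod p)) : Matrix (Fin 2) (Fin 2) (ZMod p)).trace • 1 := by
  have hy : ((Φ (galoisRepTorsion W p σ) : GL (Fin 2) (ZMod p)) : Matrix (Fin 2) (Fin 2) (ZMod p)) ∈ k := hσ
  rw [map_mul, map_mul, map_inv, map_mul, map_mul, map_inv, Units.val_mul, Units.val_mul,
    Matrix.coe_units_inv]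
  exact add_conj_eq_trace_smul_one hk hy (frob_mem_normalizer W p Φ hGN τ) hτ

/-- **At a good prime `ℓ ≠ p` with Frobenius `σ ∈ U` ("`ℓ` split in `K`"):
`Φ(ρ̄ σ) + Φ(ρ̄(τστ⁻¹)) = a_ℓ(E)·1`** for any `τ ∉ U` — the two summands are the values
`χ̄(Frob_w)`, `χ̄(Frob_w̄)` of the character `χ̄ : U → kˣ` with `ρ̄ ≅ Ind χ̄` at the two primes `w, w̄ = τw`
of `K` above `ℓ`, whose sum is the trace `a_ℓ(E) mod p`.  Frame with the trace clause.
[cite: Serre1972, §2.2 and §4.2 c)] [cite: Serre1981, §8.1 eq. (238) (p. 188)] -/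
theorem frob_add_conj_eq_frobeniusTrace_smul_one_of_mem (hk : IsField k)
    (htr : letI : Module (ZMod p) (geomTorsion W p) := AddSubgroup.torsionBy.zmodModule
      ∀ g : Multiplicative (AddAut (geomTorsion W p)),
        Matrix.trace ((Φ g : GL (Fin 2) (ZMod p)) : Matrix (Fin 2) (Fin 2) (ZMod p)) =
          LinearMap.trace (ZMod p) (geomTorsion W p) ((Multiplicative.toAdd g).toAddMonoidHom.toZModLinearMap p))
    (hGN : (galoisRepTorsion W p).range.map Φ.toMonoidHom ≤
      Subgroup.normalizer (Serre1972.unitGroup k : Set (GL (Fin 2) (ZMod p))))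
    {ℓ : ℕ} [Fact ℓ.Prime] (hℓp : ℓ ≠ p) (hgood : W.HasGoodReductionAtPrime ℓ)
    {v : HeightOneSpectrum (𝓞 ℚ)} (hv : (primesEquiv v : ℕ) = ℓ)
    {𝔓 : Ideal (absIntegers (𝓞 ℚ) ℚ)} (h𝔓 : 𝔓 ∈ v.primesAbove)
    {σ τ : absoluteGaloisGroup ℚ} (hσF : IsArithFrobAt (𝓞 ℚ) σ 𝔓)
    (hσ : σ ∈ ((Serre1972.unitGroup k).comap Φ.toMonoidHom).comap (galoisRepTorsion W p))
    (hτ : τ ∉ ((Serre1972.unitGroup k).comap Φ.toMonoidHom).comap (galoisRepTorsion W p)) :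
    ((Φ (galoisRepTorsion W p σ) : GL (Fin 2) (ZMod p)) : Matrix (Fin 2) (Fin 2) (ZMod p)) +
        ((Φ (galoisRepTorsion W p (τ * σ * τ⁻¹)) : GL (Fin 2) (ZMod p)) : Matrix (Fin 2) (Fin 2) (ZMod p)) =
      ((W.frobeniusTrace ℓ : ℤ) : ZMod p) • 1 := by
  letI : Module (ZMod p) (geomTorsion W p) := AddSubgroup.torsionBy.zmodModule
  rw [frob_add_conj_eq_trace_smul_one_of_mem W p Φ hk hGN hσ hτ, htr,
    W.trace_galoisRepTorsion_frobenius_eq p hℓp hgood hv h𝔓 hσF]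

omit [W.IsElliptic] [W.IsGloballyMinimal] in
/-- The conjugate Frobenius `τστ⁻¹` of a `σ ∈ U` lies in `U` (`U` is normal: index `2` — here simply
because `kˣ ⊴ N(kˣ)`), and both `Φ(ρ̄ σ)`, `Φ(ρ̄(τστ⁻¹))` lie in `k`. [folklore] -/
theorem conj_mem_of_mem
    (hGN : (galoisRepTorsion W p).range.map Φ.toMonoidHom ≤
      Subgroup.normalizer (Serre1972.unitGroup k : Set (GL (Fin 2) (ZMod p))))
    {σ : absoluteGaloisGroup ℚ} (τ : absoluteGaloisGroup ℚ)
    (hσ : σ ∈ ((Serre1972.unitGroup k).comap Φ.toMonoidHom).comap (galoisRepTorsion W p)) :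
    τ * σ * τ⁻¹ ∈ ((Serre1972.unitGroup k).comap Φ.toMonoidHom).comap (galoisRepTorsion W p) := by
  have hn := frob_mem_normalizer W p Φ hGN τ
  rw [Subgroup.mem_normalizer_iff] at hn
  change Φ (galoisRepTorsion W p (τ * σ * τ⁻¹)) ∈ Serre1972.unitGroup k
  rw [map_mul, map_mul, map_inv, map_mul, map_mul, map_inv]
  exact (hn _).mp hσ

end Curve

end Summit.BirchSwinnertonDyer.BirchSwinnertonDyer.Theorems.SmallImageLambdaLowerThreeNsThetaPartner

end
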